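import Mathlib
import HarnessLib
import Summits.ResolutionOfSingularities.ResolutionOfSingularities.Theorems.WildQuotientsWildQuotientResolutionS1aKillJordanChain

/-!
# S1a — F5: THE (1,1) CONORMAL TYPE KILLS (KC4-clone), with the linear `J₂ ⊕ J₂` and its boundary version as inhabitants

[OURS · L1 W4.5c · lead-1 g10; plan-1 g13 ASSIGNMENT v10.26 (6b) / SIG FLAG v1 F5] — NOT statements of the manuscript; counted 0; AI-level work, weaker than
expert review. Crux stmt-ResolutionOfSingularities-17941 `CyclicQuotientFourfolds`, line `s1a-logminvertex` v10, K-side (`stub_killTouchReachAux`).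
The (1,1) conormal type is the census' A₁ plane `x₂ = x₃` and every special point over an aux centre on it (plan-1 KILL-SEMANTICS v1 §2).

* ★ `irrelevant_of_conormalType` — centre `(x₁, y) = (f 0, f 1)` with weights `(1, 1)`, elements `y₃, y₄`, units `h, u`, rows `σ y₃ − y₃ − β h x₁ ∈ β 𝒥₂`,
  `σ y₄ − y₄ − β u y ∈ β 𝒥₂` (`in₁ θ(y₃) = h̄ x̄₁ʼ`, `in₁ θ(y₄) = ū ȳʼ`) ⇒ hypothesis (i) of KC3 with `N = 1`; `cobordantKillCert_conormalType` (KC3∘F5),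
  ★★ `ringKillData_conormalType` (KC2∘KC3∘F5, (a′) on generators);
* polynomial helpers for any number of variables: `isRegular_X_X`, `range_X_X`, `isRegularRing_quotient_X_X`, `closure_C_X_eq_top`;
* ★★★ `ringKillData_conormalBoundaryLeaf` — `k[x₀, …, x₄]`, `σ` ANY ring automorphism fixing constants, `x₀, x₁, x₄` with `σ x₂ = x₂ + x₄^m x₀`,
  `σ x₃ = x₃ + x₄^m x₁`: centre `(x₀, x₁)`, weights `(1, 1)`, `β = x₄^m` ⇒ `RingKillData`, all `p`, all `m`;
  ★★★ `ringKillData_conormalLeaf` — `k[x₀..x₃]`, the linear `J₂ ⊕ J₂` (`σ x₂ = x₂ + x₀`, `σ x₃ = x₃ + x₁`; `β = 1`): the Király–Lütkebohmert blow-up of the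
  fixed plane as a one-move kill certificate, all `p` (`exists_conormalAut`: non-vacuity).
-/

set_option linter.dupNamespace false

noncomputable section

open Literature.AlgebraicGeometry.Resolution
open scoped LaurentPolynomial
open MvPolynomial
open Summit.ResolutionOfSingularities.ResolutionOfSingularities.Theorems.WildQuotientResolution.S1.CoarseChart
open Summit.ResolutionOfSingularities.ResolutionOfSingularities.Theorems.WildQuotientResolution.S1.BlowupCharts

namespace Summit.ResolutionOfSingularities.ResolutionOfSingularities.Theorems.WildQuotientResolution.S1.KillCert

universe u

section Conormal

variable {B : Type u} [CommRing B] (σ : B ≃+* B) {p : ℕ} (hp : 0 < p) (hσp : ∀ x : B, (⇑σ)^[p] x = x)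

/-- ★ **F5 — THE (1,1) CONORMAL TYPE.** Centre `f = (x₁, y)` with weights `(1, 1)`, elements `y₃, y₄`, units `h, u` and the rows
`σ y₃ − y₃ − β h x₁ ∈ β 𝒥₂`, `σ y₄ − y₄ − β u y ∈ β 𝒥₂`. Then hypothesis (i) of KC3 holds with `N = 1`:
`σ_R y₃ − y₃ = βs (h x₁ʼ + s·j₃t²)`, `σ_R y₄ − y₄ = βs (u yʼ + s·j₄t²)`. [OURS · L1 W4.5c · SIG FLAG v1 F5; NOT a statement of the manuscript] -/
theorem irrelevant_of_conormalType (f : Fin 2 → B) (β y₃ y₄ h u : B) (hh : IsUnit h) (hu : IsUnit u)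
    (hσJ : ∀ n : ℕ, ((weightedFiltration f ![1, 1]).ideal n).map (σ : B →+* B) ≤ (weightedFiltration f ![1, 1]).ideal n)
    (c₃ : σ y₃ - y₃ - β * h * f 0 ∈ Ideal.span {β} * (weightedFiltration f ![1, 1]).ideal 2)
    (c₄ : σ y₄ - y₄ - β * u * f 1 ∈ Ideal.span {β} * (weightedFiltration f ![1, 1]).ideal 2) :
    cobordantAlgebra.vertexIdeal f ![1, 1] ≤
      (augmentationIdeal (sigmaR σ f ![1, 1] hσJ hp hσp)).colon
          (Ideal.span {algebraMap B (↥(cobordantAlgebra f ![1, 1])) β * cobordantAlgebra.s f ![1, 1]}) ⊔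
        cobordantAlgebra.excIdeal f ![1, 1] := by
  obtain ⟨j₃, hj₃, e₃⟩ := Ideal.mem_span_singleton_mul.mp c₃
  obtain ⟨j₄, hj₄, e₄⟩ := Ideal.mem_span_singleton_mul.mp c₄
  have hw0 : (![1, 1] : Fin 2 → ℕ) 0 = 1 := rfl
  have hw1 : (![1, 1] : Fin 2 → ℕ) 1 = 1 := rfl
  have hx' : ∀ i : Fin 2, algebraMap B (↥(cobordantAlgebra f ![1, 1])) (f i) =
      cobordantAlgebra.s f ![1, 1] ^ ((![1, 1] : Fin 2 → ℕ) i) * cobordantAlgebra.u' f ![1, 1] i := fun i =>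
    cobordantAlgebra.algebraMap_u f ![1, 1] i
  have hz₃ := algebraMap_eq_s_pow_mul f ![1, 1] ⟨_, C_mul_T_mem_cobordantAlgebra f ![1, 1] hj₃⟩ rfl
  have hz₄ := algebraMap_eq_s_pow_mul f ![1, 1] ⟨_, C_mul_T_mem_cobordantAlgebra f ![1, 1] hj₄⟩ rfl
  have m0 : cobordantAlgebra.u' f ![1, 1] 0 ∈
      (augmentationIdeal (sigmaR σ f ![1, 1] hσJ hp hσp)).colon
          (Ideal.span {algebraMap B (↥(cobordantAlgebra f ![1, 1])) β * cobordantAlgebra.s f ![1, 1]}) ⊔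
        cobordantAlgebra.excIdeal f ![1, 1] := by
    refine mem_colon_sup_excIdeal_of_unit f ![1, 1] (hh.map (algebraMap B (↥(cobordantAlgebra f ![1, 1]))))
      (z := ⟨_, C_mul_T_mem_cobordantAlgebra f ![1, 1] hj₃⟩) ?_
    rw [sigmaR_sub_eq_of_step f ![1, 1] σ hσJ hp hσp β h (y := y₃) (y' := f 0) (j := j₃) (n := 0) (by rw [e₃]; ring)
      (algebraMap B _ y₃) (cobordantAlgebra.u' f ![1, 1] 0) ⟨_, C_mul_T_mem_cobordantAlgebra f ![1, 1] hj₃⟩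
      (by rw [pow_zero, mul_one]) (by rw [hx' 0, hw0]) hz₃]
    exact sub_mem_augmentationIdeal _ _
  have m1 : cobordantAlgebra.u' f ![1, 1] 1 ∈
      (augmentationIdeal (sigmaR σ f ![1, 1] hσJ hp hσp)).colon
          (Ideal.span {algebraMap B (↥(cobordantAlgebra f ![1, 1])) β * cobordantAlgebra.s f ![1, 1]}) ⊔
        cobordantAlgebra.excIdeal f ![1, 1] := by
    refine mem_colon_sup_excIdeal_of_unit f ![1, 1] (hu.map (algebraMap B (↥(cobordantAlgebra f ![1, 1]))))
      (z := ⟨_, C_mul_T_mem_cobordantAlgebra f ![1, 1] hj₄⟩) ?_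
    rw [sigmaR_sub_eq_of_step f ![1, 1] σ hσJ hp hσp β u (y := y₄) (y' := f 1) (j := j₄) (n := 0) (by rw [e₄]; ring)
      (algebraMap B _ y₄) (cobordantAlgebra.u' f ![1, 1] 1) ⟨_, C_mul_T_mem_cobordantAlgebra f ![1, 1] hj₄⟩
      (by rw [pow_zero, mul_one]) (by rw [hx' 1, hw1]) hz₄]
    exact sub_mem_augmentationIdeal _ _
  rw [cobordantAlgebra.vertexIdeal, Ideal.span_le]
  rintro _ ⟨i, rfl⟩
  fin_cases i
  exacts [m0, m1]

/-- **KC3 ∘ F5**: boundary-admissibility, isolation and the two conormal rows give the cobordant kill certificate `β s`. [OURS · L1 W4.5c] -/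
theorem cobordantKillCert_conormalType (f : Fin 2 → B) (β y₃ y₄ h u : B) (hh : IsUnit h) (hu : IsUnit u)
    (hσJ : ∀ n : ℕ, ((weightedFiltration f ![1, 1]).ideal n).map (σ : B →+* B) ≤ (weightedFiltration f ![1, 1]).ideal n)
    (hadm : ∀ (n : ℕ) (y : B), y ∈ (weightedFiltration f ![1, 1]).ideal n →
      σ y - y ∈ Ideal.span {β} * (weightedFiltration f ![1, 1]).ideal (n + 1))
    (hiso : ∃ N : ℕ, Ideal.span (Set.range f) ^ N ≤ (augmentationIdeal σ).colon (Ideal.span {β}))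
    (c₃ : σ y₃ - y₃ - β * h * f 0 ∈ Ideal.span {β} * (weightedFiltration f ![1, 1]).ideal 2)
    (c₄ : σ y₄ - y₄ - β * u * f 1 ∈ Ideal.span {β} * (weightedFiltration f ![1, 1]).ideal 2) :
    CobordantKillCert f ![1, 1] σ hσJ hp hσp (algebraMap B (↥(cobordantAlgebra f ![1, 1])) β * cobordantAlgebra.s f ![1, 1]) :=
  cobordantKillCert_of_admissible_of_irrelevant f ![1, 1] σ hσJ hp hσp β hadm hiso
    ⟨1, by rw [pow_one]; exact irrelevant_of_conormalType σ hp hσp f β y₃ y₄ h u hh hu hσJ c₃ c₄⟩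

end Conormal

section Node

variable {p : ℕ} {m : ℕ} (r : Fin m → ℕ) (B : Type u) [CommRing B] (𝒜 : (Π j : Fin m, ZMod (r j)) → AddSubgroup B)
  [GradedRing 𝒜] (σ : B ≃+* B)

/-- ★★ **KC2 ∘ KC3 ∘ F5 — THE TYPED CONORMAL KILL.** In any node `(B, 𝒜, σ)`: a homogeneous K1′-regular centre `(x₁, y) = (f 0, f 1)` with weights `(1, 1)` and a
Veronese degree; a boundary element `β` with (a′) checked on a generating set `G` (`σ g − g ∈ β 𝒥₁`) and on the centre (`σ x₁ − x₁, σ y − y ∈ β 𝒥₂`); isolation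
`(x₁, y)^N ≤ (augIdeal σ : β)`; the conormal rows with units `h, u`. Then `RingKillData p r B 𝒜 σ`, for every `p`.
[OURS · L1 W4.5c · SIG FLAG v1 F5; NOT a statement of the manuscript] -/
theorem ringKillData_conormalType (f : Fin 2 → B) (δ : Fin 2 → Π j : Fin m, ZMod (r j)) (d : ℕ)
    (hf : ∀ i, f i ∈ 𝒜 (δ i))
    (hK1 : RingTheory.Sequence.IsRegular B (List.ofFn f)) (hK1' : IsRegularRing (B ⧸ Ideal.span (Set.range f)))
    (hver : VeroneseNormalised 𝒜 f ![1, 1] d) (β y₃ y₄ h u : B) (hh : IsUnit h) (hu : IsUnit u)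
    (G : Set B) (hG : Subring.closure G = ⊤)
    (h0 : ∀ g ∈ G, σ g - g ∈ Ideal.span {β} * (weightedFiltration f ![1, 1]).ideal 1)
    (c₁ : σ (f 0) - f 0 ∈ Ideal.span {β} * (weightedFiltration f ![1, 1]).ideal 2)
    (c₂ : σ (f 1) - f 1 ∈ Ideal.span {β} * (weightedFiltration f ![1, 1]).ideal 2)
    (hiso : ∃ N : ℕ, Ideal.span (Set.range f) ^ N ≤ (augmentationIdeal σ).colon (Ideal.span {β}))
    (c₃ : σ y₃ - y₃ - β * h * f 0 ∈ Ideal.span {β} * (weightedFiltration f ![1, 1]).ideal 2)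
    (c₄ : σ y₄ - y₄ - β * u * f 1 ∈ Ideal.span {β} * (weightedFiltration f ![1, 1]).ideal 2) :
    RingKillData p r B 𝒜 σ := by
  have hfw : ∀ i : Fin 2, σ (f i) - f i ∈ Ideal.span {β} * (weightedFiltration f ![1, 1]).ideal ((![1, 1] : Fin 2 → ℕ) i + 1) := by
    intro i
    fin_cases i
    exacts [c₁, c₂]
  have hadm := admissible_of_generators f ![1, 1] σ β G hG h0 hfw
  exact ringKillData_of_cert r B 𝒜 σ f δ ![1, 1] d (by norm_num) hf (fun i => by fin_cases i <;> norm_num) hK1 hK1'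
    (map_le_of_admissible f ![1, 1] σ β hadm) hver fun hp hσp =>
      ⟨_, cobordantKillCert_conormalType σ hp hσp f β y₃ y₄ h u hh hu (map_le_of_admissible f ![1, 1] σ β hadm) hadm hiso c₃ c₄⟩

end Node

/-! ## Polynomial helpers in any number of variables -/

section Poly

variable (k : Type) [Field k] {N : ℕ}

/-- Two distinct variables form a regular sequence on `k[x₀, …, x_{N-1}]`. [folklore] -/
theorem isRegular_X_X (i j : Fin N) (hij : i ≠ j) :
    RingTheory.Sequence.IsRegular (MvPolynomial (Fin N) k) (List.ofFn (![X i, X j] : Fin 2 → MvPolynomial (Fin N) k)) := by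
  have hl : List.ofFn (![X i, X j] : Fin 2 → MvPolynomial (Fin N) k) = ([i, j] : List (Fin N)).map X := by
    simp [List.ofFn_succ]
  rw [hl]
  refine ⟨isWeaklyRegular_map_X (R := k) [i, j] (by simp [hij]), ?_⟩
  intro htop
  rw [smul_eq_mul, Ideal.mul_top] at htop
  have h1 : (1 : MvPolynomial (Fin N) k) ∈ Ideal.ofList (([i, j] : List (Fin N)).map (X : Fin N → MvPolynomial (Fin N) k)) := by
    rw [← htop]; trivial
  have hle : Ideal.ofList (([i, j] : List (Fin N)).map (X : Fin N → MvPolynomial (Fin N) k)) ≤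
      RingHom.ker (constantCoeff : MvPolynomial (Fin N) k →+* k) := by
    rw [Ideal.ofList, Ideal.span_le]
    intro x hx
    simp only [List.map_cons, List.map_nil, List.mem_cons, List.not_mem_nil, or_false, Set.mem_setOf_eq] at hx
    rcases hx with rfl | rfl <;> simp [RingHom.mem_ker, constantCoeff_X]
  have := hle h1
  rw [RingHom.mem_ker, map_one] at this
  exact one_ne_zero this

omit [Field k] in
/-- `Set.range ![xᵢ, xⱼ] = X '' {i, j}`. -/
theorem range_X_X [CommSemiring k] (i j : Fin N) :
    Set.range (![X i, X j] : Fin 2 → MvPolynomial (Fin N) k) = X '' ({i, j} : Set (Fin N)) := by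
  ext x
  simp only [Set.mem_range, Set.mem_image, Set.mem_insert_iff, Set.mem_singleton_iff]
  constructor
  · rintro ⟨l, rfl⟩
    fin_cases l
    · exact ⟨i, Or.inl rfl, rfl⟩
    · exact ⟨j, Or.inr rfl, rfl⟩
  · rintro ⟨l, rfl | rfl, rfl⟩
    · exact ⟨0, rfl⟩
    · exact ⟨1, rfl⟩

/-- `k[x]/(xᵢ, xⱼ)` is a polynomial ring, hence regular. [folklore] -/
theorem isRegularRing_quotient_X_X (i j : Fin N) :
    IsRegularRing (MvPolynomial (Fin N) k ⧸ Ideal.span (Set.range (![X i, X j] : Fin 2 → MvPolynomial (Fin N) k))) := by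
  rw [range_X_X]
  haveI : IsRegularRing (MvPolynomial {l : Fin N // l ∉ ({i, j} : Set (Fin N))} k) := inferInstance
  exact IsRegularRing.of_ringEquiv (quotientSpanXEquiv (R := k) ({i, j} : Set (Fin N))).toRingEquiv.symm

/-- `k[x₀, …, x_{N-1}]` is generated as a ring by the constants and the variables. [folklore] -/
theorem closure_C_X_eq_top :
    Subring.closure (Set.range (C : k → MvPolynomial (Fin N) k) ∪ Set.range (X : Fin N → MvPolynomial (Fin N) k)) = ⊤ := by
  have h := Algebra.adjoin_eq_ring_closure (R := k) (Set.range (X : Fin N → MvPolynomial (Fin N) k))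
  rw [adjoin_range_X] at h
  rw [← show (algebraMap k (MvPolynomial (Fin N) k) : k → MvPolynomial (Fin N) k) = C from rfl, ← h]
  rfl

end Poly

/-! ## The conormal leaf on `𝔸⁵` with boundary, and the linear `J₂ ⊕ J₂` on `𝔸⁴` -/

section Instances

variable (k : Type) [Field k]

/-- ★★★ **THE CONORMAL LEAF WITH BOUNDARY IS KILLED BY THE (1,1)-BLOW-UP OF ITS PLANE, ALL `p`.** On `B = k[x₀, …, x₄]` with ANY trivial grading, let `σ` be a
ring automorphism fixing the constants and `x₀, x₁, x₄` with `σ x₂ = x₂ + x₄^m x₀`, `σ x₃ = x₃ + x₄^m x₁` (`m ≥ 0`; order `p` in characteristic `p`). Then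
`RingKillData p r B 𝒜 σ` for the centre `(x₀, x₁)` with weights `(1, 1)` and `β = x₄^m`: on every σ-fixed chart of the cobordant blow-up of the fixed
3-fold `V(x₀, x₁)` the augmentation ideal of `σʼ` is `(x₄^m s)`. [OURS · L1 W4.5c · ASSIGNMENT v10.26 (6b); NOT a statement of the manuscript] -/
theorem ringKillData_conormalBoundaryLeaf (p : ℕ) (r : Fin 0 → ℕ) (m : ℕ)
    (𝒜 : (Π j : Fin 0, ZMod (r j)) → AddSubgroup (MvPolynomial (Fin 5) k)) [GradedRing 𝒜] (h𝒜 : ∀ i, 𝒜 i = ⊤)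
    (σ : MvPolynomial (Fin 5) k ≃+* MvPolynomial (Fin 5) k) (hC : ∀ a : k, σ (C a) = C a)
    (h0 : σ (X 0) = X 0) (h1 : σ (X 1) = X 1) (h2 : σ (X 2) = X 2 + X 4 ^ m * X 0) (h3 : σ (X 3) = X 3 + X 4 ^ m * X 1)
    (h4 : σ (X 4) = X 4) :
    RingKillData p r (MvPolynomial (Fin 5) k) 𝒜 σ := by
  classical
  let f : Fin 2 → MvPolynomial (Fin 5) k := ![X 0, X 1]
  let β : MvPolynomial (Fin 5) k := X 4 ^ m
  have hf0 : f 0 = X 0 := rfl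
  have hf1 : f 1 = X 1 := rfl
  have hf : ∀ i, f i ∈ 𝒜 ((fun _ => 0) i) := fun i => by rw [h𝒜]; trivial
  have hT2 : ∃ t : Finset (MvPolynomial (Fin 5) k),
      Subring.closure (((𝒜 0 : AddSubgroup (MvPolynomial (Fin 5) k)) : Set (MvPolynomial (Fin 5) k)) ∪
        (↑t : Set (MvPolynomial (Fin 5) k))) = ⊤ := by
    refine ⟨∅, ?_⟩
    rw [h𝒜 0, Finset.coe_empty, Set.union_empty]
    exact top_le_iff.mp fun x _ => Subring.subset_closure trivial
  obtain ⟨d, hver⟩ := Veronese.veroneseNormalisation _ _ 𝒜 hT2 2 f (fun _ => 0) ![1, 1] hf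
  have hX0 : X 0 ∈ (weightedFiltration f ![1, 1]).ideal 1 := mem_weightedFiltration_ideal f ![1, 1] 0
  have hX1 : X 1 ∈ (weightedFiltration f ![1, 1]).ideal 1 := mem_weightedFiltration_ideal f ![1, 1] 1
  have hinc2 : σ (X 2) - X 2 = β * X 0 := by rw [h2]; ring
  have hinc3 : σ (X 3) - X 3 = β * X 1 := by rw [h3]; ring
  refine ringKillData_conormalType r (MvPolynomial (Fin 5) k) 𝒜 σ f (fun _ => 0) d hf
    (isRegular_X_X k 0 1 (by decide)) (isRegularRing_quotient_X_X k 0 1) hver β (X 2) (X 3) 1 1 isUnit_one isUnit_one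
    (Set.range (C : k → MvPolynomial (Fin 5) k) ∪ Set.range (X : Fin 5 → MvPolynomial (Fin 5) k))
    (closure_C_X_eq_top k) ?_ ?_ ?_ ?_ ?_ ?_
  · rintro g (⟨a, rfl⟩ | ⟨i, rfl⟩)
    · rw [hC, sub_self]; exact Ideal.zero_mem _
    · fin_cases i
      · rw [Fin.zero_eta, h0, sub_self]; exact Ideal.zero_mem _
      · rw [Fin.mk_one, h1, sub_self]; exact Ideal.zero_mem _
      · change σ (X 2) - X 2 ∈ _
        rw [hinc2]; exact Ideal.mul_mem_mul (Ideal.mem_span_singleton_self β) hX0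
      · change σ (X 3) - X 3 ∈ _
        rw [hinc3]; exact Ideal.mul_mem_mul (Ideal.mem_span_singleton_self β) hX1
      · change σ (X 4) - X 4 ∈ _
        rw [h4, sub_self]; exact Ideal.zero_mem _
  · rw [hf0, h0, sub_self]; exact Ideal.zero_mem _
  · rw [hf1, h1, sub_self]; exact Ideal.zero_mem _
  · refine ⟨1, ?_⟩
    rw [pow_one, Ideal.span_le]
    rintro _ ⟨i, rfl⟩
    rw [SetLike.mem_coe, Ideal.mem_colon_span_singleton]
    fin_cases i
    · change f 0 * β ∈ _
      rw [hf0, mul_comm, ← hinc2]; exact sub_mem_augmentationIdeal σ _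
    · change f 1 * β ∈ _
      rw [hf1, mul_comm, ← hinc3]; exact sub_mem_augmentationIdeal σ _
  · rw [hf0, hinc2, mul_one, sub_self]; exact Ideal.zero_mem _
  · rw [hf1, hinc3, mul_one, sub_self]; exact Ideal.zero_mem _

/-- **The linear `J₂ ⊕ J₂` exists**: `x₂ ↦ x₂ + x₀`, `x₃ ↦ x₃ + x₁` extends to a `k`-algebra automorphism of `k[x₀..x₃]`. [OURS · L1 W4.5c] -/
theorem exists_conormalAut :
    ∃ σ : MvPolynomial (Fin 4) k ≃+* MvPolynomial (Fin 4) k, (∀ a : k, σ (C a) = C a) ∧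
      σ (X 0) = X 0 ∧ σ (X 1) = X 1 ∧ σ (X 2) = X 2 + X 0 ∧ σ (X 3) = X 3 + X 1 := by
  let φ : MvPolynomial (Fin 4) k →ₐ[k] MvPolynomial (Fin 4) k := aeval ![X 0, X 1, X 2 + X 0, X 3 + X 1]
  let ψ : MvPolynomial (Fin 4) k →ₐ[k] MvPolynomial (Fin 4) k := aeval ![X 0, X 1, X 2 - X 0, X 3 - X 1]
  have hφ : ∀ i, φ (X i) = (![X 0, X 1, X 2 + X 0, X 3 + X 1] : Fin 4 → MvPolynomial (Fin 4) k) i := fun i => aeval_X _ i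
  have hψ : ∀ i, ψ (X i) = (![X 0, X 1, X 2 - X 0, X 3 - X 1] : Fin 4 → MvPolynomial (Fin 4) k) i := fun i => aeval_X _ i
  have h1 : φ.comp ψ = AlgHom.id k _ := by
    refine algHom_ext fun i => ?_
    rw [AlgHom.comp_apply, AlgHom.id_apply]
    fin_cases i <;>
      simp only [hψ, Fin.zero_eta, Fin.mk_one, Fin.reduceFinMk, Matrix.cons_val_zero, Matrix.cons_val_one, Matrix.cons_val,
        map_sub, hφ] <;> ring
  have h2 : ψ.comp φ = AlgHom.id k _ := by
    refine algHom_ext fun i => ?_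
    rw [AlgHom.comp_apply, AlgHom.id_apply]
    fin_cases i <;>
      simp only [hφ, Fin.zero_eta, Fin.mk_one, Fin.reduceFinMk, Matrix.cons_val_zero, Matrix.cons_val_one, Matrix.cons_val,
        map_add, hψ] <;> ring
  refine ⟨(AlgEquiv.ofAlgHom φ ψ h1 h2).toRingEquiv, fun a => ?_, ?_, ?_, ?_, ?_⟩
  · exact φ.commutes a
  all_goals
    change φ (X _) = _
    rw [hφ]
    simp

/-- ★★★ **THE LINEAR `J₂ ⊕ J₂` IS KILLED BY THE KIRÁLY–LÜTKEBOHMERT BLOW-UP OF ITS FIXED PLANE, ALL `p`.** On `B = k[x₀..x₃]` with ANY trivial grading, let `σ` be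
a ring automorphism fixing the constants, `x₀` and `x₁` with `σ x₂ = x₂ + x₀`, `σ x₃ = x₃ + x₁`. Then `RingKillData p r B 𝒜 σ` for the centre `(x₀, x₁)` with
weights `(1, 1)` and `β = 1`: the augmentation ideal of `σʼ` is `(s)` on every σ-fixed chart. [OURS · L1 W4.5c · ASSIGNMENT v10.26 (6b); NOT a statement
of the manuscript] -/
theorem ringKillData_conormalLeaf (p : ℕ) (r : Fin 0 → ℕ)
    (𝒜 : (Π j : Fin 0, ZMod (r j)) → AddSubgroup (MvPolynomial (Fin 4) k)) [GradedRing 𝒜] (h𝒜 : ∀ i, 𝒜 i = ⊤)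
    (σ : MvPolynomial (Fin 4) k ≃+* MvPolynomial (Fin 4) k) (hC : ∀ a : k, σ (C a) = C a)
    (h0 : σ (X 0) = X 0) (h1 : σ (X 1) = X 1) (h2 : σ (X 2) = X 2 + X 0) (h3 : σ (X 3) = X 3 + X 1) :
    RingKillData p r (MvPolynomial (Fin 4) k) 𝒜 σ := by
  classical
  let f : Fin 2 → MvPolynomial (Fin 4) k := ![X 0, X 1]
  have hf0 : f 0 = X 0 := rfl
  have hf1 : f 1 = X 1 := rfl
  have hf : ∀ i, f i ∈ 𝒜 ((fun _ => 0) i) := fun i => by rw [h𝒜]; trivial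
  have hT2 : ∃ t : Finset (MvPolynomial (Fin 4) k),
      Subring.closure (((𝒜 0 : AddSubgroup (MvPolynomial (Fin 4) k)) : Set (MvPolynomial (Fin 4) k)) ∪
        (↑t : Set (MvPolynomial (Fin 4) k))) = ⊤ := by
    refine ⟨∅, ?_⟩
    rw [h𝒜 0, Finset.coe_empty, Set.union_empty]
    exact top_le_iff.mp fun x _ => Subring.subset_closure trivial
  obtain ⟨d, hver⟩ := Veronese.veroneseNormalisation _ _ 𝒜 hT2 2 f (fun _ => 0) ![1, 1] hf
  have hX0 : X 0 ∈ (weightedFiltration f ![1, 1]).ideal 1 := mem_weightedFiltration_ideal f ![1, 1] 0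
  have hX1 : X 1 ∈ (weightedFiltration f ![1, 1]).ideal 1 := mem_weightedFiltration_ideal f ![1, 1] 1
  have hinc2 : σ (X 2) - X 2 = 1 * X 0 := by rw [h2]; ring
  have hinc3 : σ (X 3) - X 3 = 1 * X 1 := by rw [h3]; ring
  have h1J : ∀ {n : ℕ} {y : MvPolynomial (Fin 4) k}, y ∈ (weightedFiltration f ![1, 1]).ideal n →
      1 * y ∈ Ideal.span {(1 : MvPolynomial (Fin 4) k)} * (weightedFiltration f ![1, 1]).ideal n :=
    fun hy => Ideal.mul_mem_mul (Ideal.mem_span_singleton_self _) hy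
  refine ringKillData_conormalType r (MvPolynomial (Fin 4) k) 𝒜 σ f (fun _ => 0) d hf
    (isRegular_X_X k 0 1 (by decide)) (isRegularRing_quotient_X_X k 0 1) hver 1 (X 2) (X 3) 1 1 isUnit_one isUnit_one
    (Set.range (C : k → MvPolynomial (Fin 4) k) ∪ Set.range (X : Fin 4 → MvPolynomial (Fin 4) k))
    (closure_C_X_eq_top k) ?_ ?_ ?_ ?_ ?_ ?_
  · rintro g (⟨a, rfl⟩ | ⟨i, rfl⟩)
    · rw [hC, sub_self]; exact Ideal.zero_mem _
    · fin_cases i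
      · rw [Fin.zero_eta, h0, sub_self]; exact Ideal.zero_mem _
      · rw [Fin.mk_one, h1, sub_self]; exact Ideal.zero_mem _
      · change σ (X 2) - X 2 ∈ _
        rw [hinc2]; exact h1J hX0
      · change σ (X 3) - X 3 ∈ _
        rw [hinc3]; exact h1J hX1
  · rw [hf0, h0, sub_self]; exact Ideal.zero_mem _
  · rw [hf1, h1, sub_self]; exact Ideal.zero_mem _
  · refine ⟨1, ?_⟩
    rw [pow_one, Ideal.span_le]
    rintro _ ⟨i, rfl⟩
    rw [SetLike.mem_coe, Ideal.mem_colon_span_singleton, mul_one]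
    fin_cases i
    · change f 0 ∈ _
      rw [hf0, ← one_mul (X 0 : MvPolynomial (Fin 4) k), ← hinc2]; exact sub_mem_augmentationIdeal σ _
    · change f 1 ∈ _
      rw [hf1, ← one_mul (X 1 : MvPolynomial (Fin 4) k), ← hinc3]; exact sub_mem_augmentationIdeal σ _
  · rw [hf0, hinc2, mul_one, sub_self]; exact Ideal.zero_mem _
  · rw [hf1, hinc3, mul_one, sub_self]; exact Ideal.zero_mem _

/-- **… so the linear `J₂ ⊕ J₂` with ITS OWN automorphism inhabits `RingKillData`** (non-vacuity by `exists_conormalAut`). [OURS · L1 W4.5c] -/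
theorem exists_ringKillData_conormalLeaf (p : ℕ) (r : Fin 0 → ℕ)
    (𝒜 : (Π j : Fin 0, ZMod (r j)) → AddSubgroup (MvPolynomial (Fin 4) k)) [GradedRing 𝒜] (h𝒜 : ∀ i, 𝒜 i = ⊤) :
    ∃ σ : MvPolynomial (Fin 4) k ≃+* MvPolynomial (Fin 4) k,
      σ (X 2) = X 2 + X 0 ∧ σ (X 3) = X 3 + X 1 ∧ RingKillData p r (MvPolynomial (Fin 4) k) 𝒜 σ := by
  obtain ⟨σ, hC, h0, h1, h2, h3⟩ := exists_conormalAut k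
  exact ⟨σ, h2, h3, ringKillData_conormalLeaf k p r 𝒜 h𝒜 σ hC h0 h1 h2 h3⟩

end Instances

end Summit.ResolutionOfSingularities.ResolutionOfSingularities.Theorems.WildQuotientResolution.S1.KillCert

end
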